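import Mathlib
import HarnessLib

/-!
# Route `PhantomRMYoshida`, crux `StableYoshidaCongruence` (stmt-Langlands-13640), line
# `burkhardt-weddle-two-three-anchor`: lattices over a valuation ring adapted to a flag

Helper for the lead's stub `stub_residualLattice` (clauses (M2)–(M4)).  Let `O ⊆ F` be a valuation subring
of a field and `P ∈ GL₄(F)` (the basis of a stable lattice `L = P·O⁴` handed out by
`exists_integralModel_of_valuationSubring`).  We produce `A ∈ GL₄(O)` — a change of `O`-basis of the SAME
lattice — such that the new basis `Q = P·A` is ADAPTED to the standard flag `F·e₀ ⊂ F·e₀ ⊕ F·e₁`: the first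
basis vector lies on the line and the second in the plane (`exists_GL_adapted_flag`: the entries `(i,0)`,
`i ≠ 0`, and `(i,1)`, `i ≥ 2`, of `P·A` vanish).  Elementary: a non-zero vector of `F⁴` becomes `O`-integral
with a coordinate equal to `1` after scaling by the inverse of a coordinate of maximal valuation
(`exists_inv_mul_mem_valuationSubring`), and such a vector is a column of a matrix of `GL₄(O)` fixing the
other standard vectors (`exists_GL_mulVec_single_eq`: a rank-one update of `1` times a transposition; matrix
determinant lemma).  No module theory (finite generation, freeness, saturation) is needed.  Everything is
proved; no named facts.

References: Bourbaki, *Algèbre commutative* VI §3 n° 6 (modules over valuation rings); Serre, *Abelian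
ℓ-adic representations* (1968), Ch. I §1.1.
-/

set_option linter.dupNamespace false

noncomputable section

open Matrix

namespace Summit.Langlands.Langlands.Cruxes.StableYoshidaCongruence.BurkhardtWeddleTwoThreeAnchor

/-! ## Scaling a non-zero vector into `Oⁿ` with a unit coordinate -/

/-- Over a valuation subring `O ⊆ F`: a non-zero vector `w ∈ Fᵐ` has a coordinate `w i₀ ≠ 0` dividing all
the others in `O` (a coordinate of maximal valuation), so that `(w i₀)⁻¹ · w ∈ Oᵐ` has `i₀`-th coordinate `1`.
[folklore] -/
theorem exists_inv_mul_mem_valuationSubring {F : Type*} [Field F] (O : ValuationSubring F) {m : ℕ}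
    {w : Fin m → F} (hw : w ≠ 0) :
    ∃ i₀ : Fin m, w i₀ ≠ 0 ∧ ∀ i, (w i₀)⁻¹ * w i ∈ O := by
  classical
  have hS : (Finset.univ.filter fun i => w i ≠ 0).Nonempty := by
    by_contra h
    rw [Finset.not_nonempty_iff_eq_empty, Finset.filter_eq_empty_iff] at h
    exact hw (funext fun i => not_not.1 (h (Finset.mem_univ i)))
  obtain ⟨i₀, hi₀, hmax⟩ := Finset.exists_max_image _ (fun i => O.valuation (w i)) hS
  rw [Finset.mem_filter] at hi₀
  refine ⟨i₀, hi₀.2, fun i => ?_⟩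
  by_cases hi : w i = 0
  · rw [hi, mul_zero]; exact O.zero_mem
  · have hle := hmax i (Finset.mem_filter.2 ⟨Finset.mem_univ i, hi⟩)
    rw [← O.valuation_le_one_iff, map_mul, map_inv₀]
    have h0 : O.valuation (w i₀) ≠ 0 := (map_ne_zero _).2 hi₀.2
    calc (O.valuation (w i₀))⁻¹ * O.valuation (w i)
        ≤ (O.valuation (w i₀))⁻¹ * O.valuation (w i₀) := by gcongr
      _ = 1 := inv_mul_cancel₀ h0

/-! ## A matrix of `GLₘ(O)` with a prescribed unimodular column -/

/-- For a commutative ring `R` and `w ∈ Rᵐ` with `w i₀ = 1`, there is `A ∈ GLₘ(R)` with `A e_{j₀} = w` and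
`A e_j = e_j` for `j ∉ {j₀, i₀}`: `A = (1 + (w - e_{i₀}) e_{i₀}ᵀ) · (transposition (j₀ i₀))`, of determinant
`± w i₀ = ± 1` by the matrix determinant lemma. [folklore] -/
theorem exists_GL_mulVec_single_eq {R : Type*} [CommRing R] {m : ℕ} (w : Fin m → R) (i₀ j₀ : Fin m)
    (hw : w i₀ = 1) :
    ∃ A : GL (Fin m) R, (A : Matrix (Fin m) (Fin m) R) *ᵥ Pi.single j₀ 1 = w ∧
      ∀ j, j ≠ j₀ → j ≠ i₀ → (A : Matrix (Fin m) (Fin m) R) *ᵥ Pi.single j 1 = Pi.single j 1 := by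
  classical
  -- the rank-one update `B` with column `i₀` replaced by `w`
  set u : Fin m → R := w - Pi.single i₀ 1 with hu
  set B : Matrix (Fin m) (Fin m) R :=
    1 + replicateCol Unit u * replicateRow Unit (Pi.single i₀ (1 : R)) with hB
  have hBdet : B.det = 1 := by
    rw [hB, det_one_add_replicateCol_mul_replicateRow, single_one_dotProduct, hu, Pi.sub_apply, hw,
      Pi.single_eq_same, sub_self, add_zero]
  have hBv : ∀ x : Fin m → R, B *ᵥ x = x + x i₀ • u := by
    intro x
    rw [hB, add_mulVec, one_mulVec, ← vecMulVec_eq, vecMulVec_mulVec, single_one_dotProduct,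
      op_smul_eq_smul]
  -- the transposition `T`
  set T : Matrix (Fin m) (Fin m) R := (Equiv.swap j₀ i₀).permMatrix R with hT
  have hTdet : IsUnit T.det := by
    rw [hT, det_permutation]
    exact (Units.map (Int.castRingHom R).toMonoidHom (Equiv.Perm.sign (Equiv.swap j₀ i₀))).isUnit
  have hTv : ∀ j, T *ᵥ Pi.single j (1 : R) = Pi.single (Equiv.swap j₀ i₀ j) 1 := by
    intro j
    rw [hT, permMatrix_mulVec]
    ext i
    simp only [Function.comp_apply, Pi.single_apply]
    have hiff : (Equiv.swap j₀ i₀ i = j) ↔ (i = Equiv.swap j₀ i₀ j) :=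
      ⟨fun h => by rw [← h, Equiv.swap_apply_self], fun h => by rw [h, Equiv.swap_apply_self]⟩
    by_cases h : Equiv.swap j₀ i₀ i = j
    · rw [if_pos h, if_pos (hiff.1 h)]
    · rw [if_neg h, if_neg (mt hiff.2 h)]
  -- `A = B T`
  have hAdet : IsUnit (B * T).det := by
    rw [det_mul, hBdet, one_mul]; exact hTdet
  obtain ⟨A, hA⟩ := (Matrix.isUnit_iff_isUnit_det _).2 hAdet
  refine ⟨A, ?_, fun j hj hji => ?_⟩
  · rw [hA, ← mulVec_mulVec, hTv, Equiv.swap_apply_left, hBv, Pi.single_eq_same, one_smul, hu]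
    abel
  · rw [hA, ← mulVec_mulVec, hTv, Equiv.swap_apply_of_ne_of_ne hj hji, hBv,
      Pi.single_eq_of_ne' hji, zero_smul, add_zero]

/-! ## Columns of invertible matrices -/

/-- A column of an invertible matrix over a field is non-zero. [folklore] -/
theorem mulVec_single_ne_zero {F : Type*} [Field F] {m : ℕ} (P : GL (Fin m) F) (j : Fin m) :
    (P : Matrix (Fin m) (Fin m) F) *ᵥ Pi.single j 1 ≠ 0 := by
  intro h
  have h1 : (P⁻¹ : GL (Fin m) F).val *ᵥ ((P : Matrix (Fin m) (Fin m) F) *ᵥ Pi.single j 1) =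
      Pi.single j 1 := by
    rw [mulVec_mulVec, ← Units.val_mul, inv_mul_cancel, Units.val_one, one_mulVec]
  rw [h, mulVec_zero] at h1
  have h2 := congrFun h1 j
  rw [Pi.zero_apply, Pi.single_eq_same] at h2
  exact one_ne_zero h2.symm

/-! ## Change of integral basis adapted to the standard flag -/

section Adapted

variable {F : Type*} [Field F] (O : ValuationSubring F)

/-- Extension of scalars `GL₄(O) → GL₄(F)` on vectors: `(A ⊗ F)(x ⊗ 1) = (A x) ⊗ 1`. [folklore] -/
theorem map_subtype_mulVec_coe {m : ℕ} (A : Matrix (Fin m) (Fin m) O) (x : Fin m → O) :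
    A.map O.subtype *ᵥ (fun i => (x i : F)) = fun i => ((A *ᵥ x) i : F) := by
  funext i
  exact (RingHom.map_mulVec O.subtype A x i).symm

/-- The standard vector `e_j` of `O⁴` maps to the standard vector of `F⁴`. [folklore] -/
theorem coe_single {m : ℕ} (j : Fin m) :
    (fun i => ((Pi.single j (1 : O) : Fin m → O) i : F)) = Pi.single j 1 := by
  ext i
  by_cases h : i = j
  · subst h; simp
  · simp [Pi.single_eq_of_ne h]

/-- **An integral change of basis adapted to the flag `F e₀ ⊂ F e₀ ⊕ F e₁`.**  For a valuation subring
`O ⊆ F` and `P ∈ GL₄(F)` there is `A ∈ GL₄(O)` such that `Q = P·A` maps `e₀` into the line `F e₀` and `e₁`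
into the plane `F e₀ ⊕ F e₁`: the entries `(i,0)`, `i ≠ 0`, and `(i,1)`, `i ≥ 2`, of `Q` vanish.  (So the lattice
`P·O⁴ = Q·O⁴` has an `O`-basis whose first vector spans `L ∩ F e₀` and whose first two span `L ∩ (F e₀ ⊕ F e₁)`.)
Construction: scale `P⁻¹ e₀` to an integral vector with a unit coordinate and make it the first column of an
`A₁ ∈ GL₄(O)`; then, in the new basis, scale the component of `(P A₁)⁻¹ e₁` off `e₀` likewise and make it the
second column of an `A₂ ∈ GL₄(O)` fixing `e₀`; `A = A₁ A₂`. [folklore] -/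
theorem exists_GL_adapted_flag :
    ∀ {F : Type} [Field F] (O : ValuationSubring F) (P : GL (Fin 4) F),
      ∃ A : GL (Fin 4) O,
        (∀ i : Fin 4, i ≠ 0 →
          ((P : Matrix (Fin 4) (Fin 4) F) * (A : Matrix (Fin 4) (Fin 4) O).map O.subtype) i 0 = 0) ∧
        (∀ i : Fin 4, 2 ≤ (i : ℕ) →
          ((P : Matrix (Fin 4) (Fin 4) F) * (A : Matrix (Fin 4) (Fin 4) O).map O.subtype) i 1 = 0) := by
  intro F _ O P
  classical
  -- entries through `mulVec` of standard vectors
  have hentry : ∀ (M : Matrix (Fin 4) (Fin 4) F) (i j : Fin 4) (y : Fin 4 → F),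
      M *ᵥ Pi.single j 1 = y → M i j = y i := by
    intro M i j y h
    rw [mulVec_single_one] at h
    rw [← h]
    rfl
  -- STEP 1: the first column
  set w : Fin 4 → F := ((P⁻¹ : GL (Fin 4) F) : Matrix (Fin 4) (Fin 4) F) *ᵥ Pi.single 0 1 with hw
  have hPw : (P : Matrix (Fin 4) (Fin 4) F) *ᵥ w = Pi.single 0 1 := by
    rw [hw, mulVec_mulVec, ← Units.val_mul, mul_inv_cancel, Units.val_one, one_mulVec]
  obtain ⟨i₀, hi₀, hint⟩ := exists_inv_mul_mem_valuationSubring O (mulVec_single_ne_zero P⁻¹ 0)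
  set c : F := (w i₀)⁻¹ with hc
  set w' : Fin 4 → O := fun i => ⟨c * w i, hint i⟩ with hw'
  have hw'i₀ : w' i₀ = 1 := Subtype.ext (by
    change c * w i₀ = 1
    rw [hc, inv_mul_cancel₀ hi₀])
  obtain ⟨A₁, hA₁, -⟩ := exists_GL_mulVec_single_eq w' i₀ 0 hw'i₀
  set P₁ : Matrix (Fin 4) (Fin 4) F :=
    (P : Matrix (Fin 4) (Fin 4) F) * (A₁ : Matrix (Fin 4) (Fin 4) O).map O.subtype with hP₁
  have hP₁e₀ : P₁ *ᵥ Pi.single 0 1 = c • Pi.single 0 1 := by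
    rw [hP₁, ← mulVec_mulVec]
    conv_lhs => rw [← coe_single O 0, map_subtype_mulVec_coe O, hA₁]
    have h1 : (fun i => ((w' i : O) : F)) = c • w := by
      ext i; simp [hw', Pi.smul_apply, smul_eq_mul]
    rw [h1, mulVec_smul, hPw]
  -- `P₁` is invertible (as a product of invertible matrices)
  have hP₁unit : IsUnit P₁ := by
    rw [hP₁]
    exact P.isUnit.mul ((Matrix.GeneralLinearGroup.map O.subtype A₁).isUnit)
  obtain ⟨P₁u, hP₁u⟩ := hP₁unit
  -- STEP 2: the second column, off `e₀`
  set u : Fin 4 → F := ((P₁u⁻¹ : GL (Fin 4) F) : Matrix (Fin 4) (Fin 4) F) *ᵥ Pi.single 1 1 with hu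
  have hP₁uval : (P₁u : Matrix (Fin 4) (Fin 4) F) = P₁ := hP₁u
  have hPu : P₁ *ᵥ u = Pi.single 1 1 := by
    rw [hu, ← hP₁uval, mulVec_mulVec, ← Units.val_mul, mul_inv_cancel, Units.val_one, one_mulVec]
  set ut : Fin 4 → F := u - u 0 • Pi.single 0 1 with hut
  have hut0 : ut 0 = 0 := by simp [hut]
  have hPut : P₁ *ᵥ ut = Pi.single 1 1 - (u 0 * c) • Pi.single 0 1 := by
    rw [hut, mulVec_sub, mulVec_smul, hPu, hP₁e₀, smul_smul]
  have hut_ne : ut ≠ 0 := by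
    intro h
    have h1 := congrFun hPut 1
    rw [h, mulVec_zero] at h1
    simp at h1
  obtain ⟨i₁, hi₁, hint₁⟩ := exists_inv_mul_mem_valuationSubring O hut_ne
  have hi₁0 : i₁ ≠ 0 := fun h => hi₁ (h ▸ hut0)
  set c₂ : F := (ut i₁)⁻¹ with hc₂
  set u' : Fin 4 → O := fun i => ⟨c₂ * ut i, hint₁ i⟩ with hu'
  have hu'i₁ : u' i₁ = 1 := Subtype.ext (by
    change c₂ * ut i₁ = 1
    rw [hc₂, inv_mul_cancel₀ hi₁])
  obtain ⟨A₂, hA₂, hA₂fix⟩ := exists_GL_mulVec_single_eq u' i₁ 1 hu'i₁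
  have hA₂e₀ : (A₂ : Matrix (Fin 4) (Fin 4) O) *ᵥ Pi.single 0 1 = Pi.single 0 1 :=
    hA₂fix 0 (by decide) (Ne.symm hi₁0)
  -- `A = A₁ A₂`
  refine ⟨A₁ * A₂, fun i hi => ?_, fun i hi => ?_⟩
  · -- column 0 of `P A₁ A₂` is `c • e₀`
    have hcol : ((P : Matrix (Fin 4) (Fin 4) F) *
        ((A₁ * A₂ : GL (Fin 4) O) : Matrix (Fin 4) (Fin 4) O).map O.subtype) *ᵥ Pi.single 0 1 =
        c • Pi.single 0 1 := by
      rw [Units.val_mul, Matrix.map_mul, ← Matrix.mul_assoc, ← hP₁, ← mulVec_mulVec]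
      conv_lhs => rw [← coe_single O 0, map_subtype_mulVec_coe O, hA₂e₀, coe_single O 0]
      rw [hP₁e₀]
    rw [hentry _ i 0 _ hcol, Pi.smul_apply, Pi.single_eq_of_ne hi, smul_zero]
  · -- column 1 of `P A₁ A₂` is `c₂ • (e₁ - (u 0 * c) • e₀)`
    have hcol : ((P : Matrix (Fin 4) (Fin 4) F) *
        ((A₁ * A₂ : GL (Fin 4) O) : Matrix (Fin 4) (Fin 4) O).map O.subtype) *ᵥ Pi.single 1 1 =
        c₂ • (Pi.single 1 1 - (u 0 * c) • Pi.single 0 1) := by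
      rw [Units.val_mul, Matrix.map_mul, ← Matrix.mul_assoc, ← hP₁, ← mulVec_mulVec]
      conv_lhs => rw [← coe_single O 1, map_subtype_mulVec_coe O, hA₂]
      have h1 : (fun i => ((u' i : O) : F)) = c₂ • ut := by
        ext i; simp [hu', Pi.smul_apply, smul_eq_mul]
      rw [h1, mulVec_smul, hPut]
    have hi0 : i ≠ 0 := by intro h; subst h; simp at hi
    have hi1 : i ≠ 1 := by intro h; subst h; simp at hi
    rw [hentry _ i 1 _ hcol, Pi.smul_apply, Pi.sub_apply, Pi.smul_apply, Pi.single_eq_of_ne hi1,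
      Pi.single_eq_of_ne hi0, smul_zero, sub_zero, smul_zero]

end Adapted

end Summit.Langlands.Langlands.Cruxes.StableYoshidaCongruence.BurkhardtWeddleTwoThreeAnchor

end
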